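import Literature.AlgebraicGeometry.AbelianSchemes.PoincarePullbackKernelCountComplex
import Literature.AlgebraicGeometry.AbelianSchemes.AbelianSchemeQuotientPoincarePullback
import Literature.AlgebraicGeometry.AbelianSchemes.AbelianSchemeConstSubgroupQuotientEtale
import Literature.AlgebraicGeometry.AbelianSchemes.AbelianSchemeOverFibreDim
import Literature.AlgebraicGeometry.AbelianSchemes.AbelianSchemeConstSubgroupQuotientKernelCard
import Literature.AlgebraicGeometry.AbelianSchemes.AbelianSchemeOverMulNUnramified
import Literature.AlgebraicGeometry.HodgeTheory.AbelianVarietyIsogenyDegreeHomology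
import Literature.AlgebraicGeometry.Motives.AbelianVarietySimpleOfIsogenyAnyField
import Literature.AlgebraicGeometry.Motives.AlgPointsMapSurjectiveAlgClosed
import HarnessLib

/-!
# `#T_t · #K ≤ n^{2g}` for `π : A/K → A` at a complex point — the count of [MumfordAV1970] §15 Thm. 1 / §7 Thm. 4

Layer `Literature/AlgebraicGeometry/AbelianSchemes`, namespace `Literature.AlgebraicGeometry.AbelianSchemes.AbelianSchemeOver`.
THEOREMS ONLY (no definition, no named fact, no instance, no `sorry`).  Currency of ★ `AbelianSchemeQuotientPoincarePullback` /
★ `PoincarePullbackStabilizer` VERBATIM: `A/S` a commutative abelian scheme over a separated base `u : S → Y` (`Y` affine,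
locally Noetherian), `K ≤ A(S)` a finite subgroup of `n`-torsion sections acting freely (`hK`, `hcov`, `hfree`), the quotient
abelian scheme `A/K = A.quotientBy u K hcov hG hsm hgc` with `ψ = quotientMk : A → A/K` and `π = mulNDesc : A/K → A`
(`ψ ≫ π = [n]`), a dual pair `D = (Â, 𝒫)` of `A` and `𝒩₁ = (π × 1)^*𝒫 = poincarePullbackBundle` on `(A/K) ×_S Â`.

[MumfordAV1970] §7 Thm. 4 (p. 72): `K = ker ψ`; with `ψ ≫ π = [n]_A` and §6 App. 3 (`#A_t[n] = n^{2g}`) this gives, at a complex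
point `t` of `S`, `#ker π_t(ℂ) · #K = n^{2g}` (degrees multiply along `ψ_t ≫ π_t`, [Lange2023AbelianVarietiesComplex] Prop.
1.1.13 (b)); and [MumfordAV1970] §15 Thm. 1 (the injectivity half, ★ `DualPair.finite_and_ncard_le_natCard_kerPoints`) bounds
`T_t = {b ∈ Â_t(ℂ) | (1_{A/K} × b)^*𝒩₁ ≅ 𝒪}` by `#ker π_t(ℂ)`.  Hence **`#T_t · #K ≤ n^{2g}`** — the `hcount` binder of the (K)
closer `hStab_of_level_of_count` (cell `hodgecm-mathlib`, B-p09 (g11)), token for token.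

* §1 `fibreHom_congr`, **`fibreHom_mulN`** (`([n]_A)_s = n • 𝟙_{A_s}`);
* §2 **`fibreHom_quotientMk_comp_fibreHom_mulNDesc`** (`ψ_s ≫ π_s = n • 𝟙`), **`isIsogeny_fibreHom_quotientMk_and_mulNDesc`**
  (`ψ_s`, `π_s` isogenies when `n ≠ 0` in the field and `A/S` has relative dimension `g`),
  `natCard_kerPoints_fibreHom_quotientMk` (`#ker ψ_s(Ω) = #K`, `Ω` algebraically closed — ★
  `AbelianSchemeConstSubgroupQuotientKernelCard.natCard_ker_fibreHom_quotientMk` in the `Hom.kerPoints` currency);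
* §3 (complex points) **`natCard_kerPoints_fibreHom_mulNDesc_mul_natCard`** (`#ker π_t(ℂ) · #K = n^{2g}`) and
  **`finite_and_ncard_mul_natCard_le_pow`** (`T_t` finite, `#T_t · #K ≤ n^{2g}`).

Cell `hodgecm-mathlib` (D-0151), HECKE-LINK socket (B), the `hcount` discharge of the (K) `hStab` package (B-p02 (g11) for
B-p09 (g11); road (R-ℂ)).  Count-neutral.  HC_CM is proved only modulo the 7 printed citations until rung 0 closes.

## References
* [MumfordAV1970] D. Mumford, *Abelian Varieties* (1970), §6 Application 3 (Proposition p. 64), §7 Thm. 4 (p. 72), §15 Thm. 1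
  (p. 143).
* [Lange2023AbelianVarietiesComplex] H. Lange, *Abelian Varieties over the Complex Numbers* (2023), §1.1.2 Prop. 1.1.13 (b)
  (PDF p. 22).
* [MumfordFogartyKirwan1994] D. Mumford, J. Fogarty, F. Kirwan, *Geometric Invariant Theory*, 3rd ed. (1994), Ch. 7 §2
  Definition 7.1 (p. 129).
* [GortzWedhorn2020] U. Görtz, T. Wedhorn, *Algebraic Geometry I* (2nd ed., 2020), Section (4.7) (pp. 107–108).
-/

set_option autoImplicit false

noncomputable section

set_option backward.isDefEq.respectTransparency false

universe u

open CategoryTheory CategoryTheory.Limits AlgebraicGeometry MonoidalCategory CartesianMonoidalCategory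
open scoped MonObj

namespace Literature.AlgebraicGeometry.AbelianSchemes

namespace AbelianSchemeOver

open Literature.AlgebraicGeometry.RelativeSpec Literature.AlgebraicGeometry.AbelianVarieties
  Literature.AlgebraicGeometry.Motives

/-! ## §1 Fibres of `[n]` -/

section Generic

variable {S : Scheme.{u}} (A : AbelianSchemeOver S)

/-- `f_s = g_s` for equal homomorphisms `f = g` (the two `IsMonHom` instances are propositions).
[cite: GortzWedhorn2020, Section (4.7) (pp. 107–108)] -/
theorem fibreHom_congr {B : AbelianSchemeOver S} {f g : A.X ⟶ B.X} [IsMonHom f] [IsMonHom g] (h : f = g)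
    {Ω : Type u} [Field Ω] (s : Spec (.of Ω) ⟶ S) : fibreHom f s = fibreHom g s := by
  subst h
  rfl

/-- **`([n]_A)_s = [n]_{A_s}`**: the fibre of the multiplication `[n] = (𝟙 A)^n` of a commutative abelian scheme at a
field-valued point is `n • 𝟙` of the fibre abelian variety (the base-change functor is monoidal, ★ `map_id_pow'`;
`[n]_{A_s} = (𝟙)^n`, ★ `hom_zsmul_id`). [cite: GortzWedhorn2020, Section (4.7) (pp. 107–108)]
[cite: MumfordAV1970, §6 Application 3 (Proposition p. 64)] -/
theorem fibreHom_mulN [IsCommMonObj A.X] (n : ℕ) {Ω : Type u} [Field Ω] (s : Spec (.of Ω) ⟶ S) :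
    haveI := A.isMonHom_mulN n
    fibreHom (A.mulN n) s = (n : ℤ) • 𝟙 (A.fibre s).toAbelianVariety := by
  haveI := A.isMonHom_mulN n
  apply AbelianVariety.hom_ext
  rw [fibreHom_hom_hom_hom, AbelianVariety.hom_zsmul_id, zpow_natCast, mulN_def, map_id_pow']
  rfl

end Generic

/-! ## §2 `ψ_s` and `π_s` are isogenies; `#ker ψ_s = #K` -/

section Quotient

variable {S : Scheme.{u}} (A : AbelianSchemeOver S)
  {Y : Scheme.{u}} (u : S ⟶ Y) (K : Subgroup A.Sections) [IsCommMonObj A.X] {n : ℕ}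
  (hK : ∀ σ : K, (σ : A.Sections) ^ n = 1)
  [Finite K] [Y.IsSeparated] [IsSeparated (A.X.hom ≫ u)] [S.IsSeparated]
  (hcov : ∀ x : A.left, ∃ O : (A.translationActionOver u K).StableAffineOpens, x ∈ O.1)
  [LocallyOfFiniteType (A.X.hom ≫ u)] [IsLocallyNoetherian Y]
  (hG : ∃ _ : GrpObj (A.quotientOver u K), IsMonHom (A.quotientMk u K hcov))
  (hsm : Smooth (A.quotientOver u K).hom) (hgc : GeometricallyConnected (A.quotientOver u K).hom)
  [IsAffine Y]
  (hfree : ∀ (Ω : Type u) [Field Ω] [IsAlgClosed Ω] (x : Spec (.of Ω) ⟶ A.left) (σ : K), σ ≠ 1 →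
    x ≫ (A.translation (σ : A.Sections)).left ≠ x)

/-- **`ψ_s ≫ π_s = [n]_{A_s}`** on the fibre at a field-valued point `s` (`ψ : A → A/K`, `π : A/K → A` the descent of `[n]`,
`ψ ≫ π = [n]_A` ★ `quotientMk_comp_mulNDesc`; fibres are functorial, ★ `fibreHom_comp`). [cite: MumfordAV1970, §7 Thm. 4 (p. 72)] -/
theorem fibreHom_quotientMk_comp_fibreHom_mulNDesc {Ω : Type u} [Field Ω] (s : Spec (.of Ω) ⟶ S) :
    haveI := A.isMonHom_quotientMk u K hcov hG hsm hgc
    haveI := A.isMonHom_mulNDesc u K hK hcov hG hsm hgc hfree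
    fibreHom (A := A) (B := A.quotientBy u K hcov hG hsm hgc) (A.quotientMk u K hcov) s ≫
        fibreHom (A := A.quotientBy u K hcov hG hsm hgc) (B := A) (A.mulNDesc u K hK hcov) s =
      (n : ℤ) • 𝟙 (A.fibre s).toAbelianVariety := by
  letI : GrpObj (A.quotientOver u K) := (A.quotientBy u K hcov hG hsm hgc).grpObj
  haveI := A.isMonHom_quotientMk u K hcov hG hsm hgc
  haveI := A.isMonHom_mulNDesc u K hK hcov hG hsm hgc hfree
  haveI := A.isMonHom_mulN n
  rw [← fibreHom_comp, A.fibreHom_congr (A.quotientMk_comp_mulNDesc u K hK hcov) s, A.fibreHom_mulN n s]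

/-- **`ψ_s : A_s → (A/K)_s` and `π_s : (A/K)_s → A_s` are ISOGENIES** at every field-valued point `s` with `n ≠ 0` in the
field: `ψ_s ≫ π_s = [n]` is an isogeny (★ `isIsogeny_zsmul_id_of_cast_ne_zero`) and `dim A_s = dim (A/K)_s = g`
(★ `isOfRelDim_quotientBy`, ★ `dim_fibre_of_isOfRelDim`), so both factors are (★ `IsIsogeny.left_of_dim_eq` /
`right_of_dim_eq`). [cite: MumfordAV1970, §7 Thm. 4 (p. 72)] [cite: MumfordAV1970, §6 Application 3 (Proposition p. 64)] -/
theorem isIsogeny_fibreHom_quotientMk_and_mulNDesc {g : ℕ} (hA : A.IsOfRelDim g) {Ω : Type u} [Field Ω]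
    (s : Spec (.of Ω) ⟶ S) (hn : (n : Ω) ≠ 0) :
    haveI := A.isMonHom_quotientMk u K hcov hG hsm hgc
    haveI := A.isMonHom_mulNDesc u K hK hcov hG hsm hgc hfree
    AbelianVariety.IsIsogeny (fibreHom (A := A) (B := A.quotientBy u K hcov hG hsm hgc) (A.quotientMk u K hcov) s) ∧
      AbelianVariety.IsIsogeny (fibreHom (A := A.quotientBy u K hcov hG hsm hgc) (B := A) (A.mulNDesc u K hK hcov) s) := by
  letI : GrpObj (A.quotientOver u K) := (A.quotientBy u K hcov hG hsm hgc).grpObj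
  haveI := A.isMonHom_quotientMk u K hcov hG hsm hgc
  haveI := A.isMonHom_mulNDesc u K hK hcov hG hsm hgc hfree
  have hn' : ((n : ℤ) : Ω) ≠ 0 := by rwa [Int.cast_natCast]
  have hiso : AbelianVariety.IsIsogeny
      (fibreHom (A := A) (B := A.quotientBy u K hcov hG hsm hgc) (A.quotientMk u K hcov) s ≫
        fibreHom (A := A.quotientBy u K hcov hG hsm hgc) (B := A) (A.mulNDesc u K hK hcov) s) := by
    rw [A.fibreHom_quotientMk_comp_fibreHom_mulNDesc u K hK hcov hG hsm hgc hfree s]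
    exact (A.fibre s).toAbelianVariety.isIsogeny_zsmul_id_of_cast_ne_zero (n : ℤ) hn'
  have hdA : (A.fibre s).toAbelianVariety.dim = g := dim_fibre_of_isOfRelDim hA s
  have hdB : ((A.quotientBy u K hcov hG hsm hgc).fibre s).toAbelianVariety.dim = g :=
    dim_fibre_of_isOfRelDim (A.isOfRelDim_quotientBy u K hcov hG hsm hgc hfree hA) s
  exact ⟨hiso.left_of_dim_eq (hdA.trans hdB.symm), hiso.right_of_dim_eq (hdB.trans hdA.symm)⟩

omit [IsCommMonObj A.X] in
include hfree in
/-- **`#ker ψ_s(Ω) = #K` at a geometric point** (`Ω` algebraically closed), in the `Hom.kerPoints` currency of ★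
`IsIsogeny.natCard_kerPoints_comp`: this is ★ `natCard_ker_fibreHom_quotientMk` ([MumfordAV1970] §7 Thm. 4: «`K = ker ψ`»,
`σ ↦ σ(s̄)` injective by freeness), `Hom.kerPoints T f` being the kernel of `f(T)` by definition.
[cite: MumfordAV1970, §7 Thm. 4 (p. 72)] [cite: MumfordFogartyKirwan1994, Ch. 7 §2 Definition 7.1 (p. 129)] -/
theorem natCard_kerPoints_fibreHom_quotientMk {Ω : Type u} [Field Ω] [IsAlgClosed Ω] (s : Spec (.of Ω) ⟶ S) :
    haveI := A.isMonHom_quotientMk u K hcov hG hsm hgc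
    Nat.card (AbelianVariety.Hom.kerPoints (specOver Ω Ω)
      (fibreHom (A := A) (B := A.quotientBy u K hcov hG hsm hgc) (A.quotientMk u K hcov) s)) = Nat.card K :=
  A.natCard_ker_fibreHom_quotientMk u K hcov hG hsm hgc hfree s

end Quotient

/-! ## §3 At a complex point: `#ker π_t(ℂ) · #K = n^{2g}` and `#T_t · #K ≤ n^{2g}` -/

section Complex

variable {S : Scheme.{0}} (A : AbelianSchemeOver S)
  {Y : Scheme.{0}} (u : S ⟶ Y) (K : Subgroup A.Sections) [IsCommMonObj A.X] {n : ℕ}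
  (hK : ∀ σ : K, (σ : A.Sections) ^ n = 1)
  [Finite K] [Y.IsSeparated] [IsSeparated (A.X.hom ≫ u)] [S.IsSeparated]
  (hcov : ∀ x : A.left, ∃ O : (A.translationActionOver u K).StableAffineOpens, x ∈ O.1)
  [LocallyOfFiniteType (A.X.hom ≫ u)] [IsLocallyNoetherian Y]
  (hG : ∃ _ : GrpObj (A.quotientOver u K), IsMonHom (A.quotientMk u K hcov))
  (hsm : Smooth (A.quotientOver u K).hom) (hgc : GeometricallyConnected (A.quotientOver u K).hom)
  (D : A.DualPair) [IsAffine Y]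
  (hfree : ∀ (Ω : Type) [Field Ω] [IsAlgClosed Ω] (x : Spec (.of Ω) ⟶ A.left) (σ : K), σ ≠ 1 →
    x ≫ (A.translation (σ : A.Sections)).left ≠ x)

/-- **`#ker π_t(ℂ) · #K = n^{2g}` at a complex point `t`** (`π : A/K → A` the descent of `[n]`, `A/S` of relative dimension `g`,
`n ≠ 0`): `ψ_t ≫ π_t = [n]_{A_t}` with `ψ_t` an isogeny, so `#ker ψ_t · #ker π_t = #A_t[n](ℂ) = n^{2g}` (Lange Prop. 1.1.13 (b),
★ `IsIsogeny.natCard_kerPoints_comp`; [MumfordAV1970] §6 App. 3, ★ `natCard_torsionPoints_eq_of_isAlgClosed`), and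
`#ker ψ_t = #K` (`natCard_kerPoints_fibreHom_quotientMk`). [cite: MumfordAV1970, §7 Thm. 4 (p. 72)]
[cite: MumfordAV1970, §6 Application 3 (Proposition p. 64)] [cite: Lange2023AbelianVarietiesComplex, §1.1.2 Prop. 1.1.13 (b) (PDF p. 22)] -/
theorem natCard_kerPoints_fibreHom_mulNDesc_mul_natCard {g : ℕ} (hA : A.IsOfRelDim g) (hn0 : n ≠ 0)
    (t : Spec (.of ℂ) ⟶ S) :
    haveI := A.isMonHom_mulNDesc u K hK hcov hG hsm hgc hfree
    Nat.card (AbelianVariety.Hom.kerPoints (specOver ℂ ℂ)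
        (fibreHom (A := A.quotientBy u K hcov hG hsm hgc) (B := A) (A.mulNDesc u K hK hcov) t)) * Nat.card K =
      n ^ (2 * g) := by
  letI : GrpObj (A.quotientOver u K) := (A.quotientBy u K hcov hG hsm hgc).grpObj
  haveI := A.isMonHom_quotientMk u K hcov hG hsm hgc
  haveI := A.isMonHom_mulNDesc u K hK hcov hG hsm hgc hfree
  have hn : (n : ℂ) ≠ 0 := by exact_mod_cast hn0
  have hn' : ((n : ℤ) : ℂ) ≠ 0 := by rwa [Int.cast_natCast]
  obtain ⟨hψ, -⟩ := A.isIsogeny_fibreHom_quotientMk_and_mulNDesc u K hK hcov hG hsm hgc hfree hA t hn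
  have h1 := hψ.natCard_kerPoints_comp
    (fibreHom (A := A.quotientBy u K hcov hG hsm hgc) (B := A) (A.mulNDesc u K hK hcov) t)
  rw [A.fibreHom_quotientMk_comp_fibreHom_mulNDesc u K hK hcov hG hsm hgc hfree t,
    ← AbelianVariety.torsionPoints_eq_kerPoints,
    (A.fibre t).toAbelianVariety.natCard_torsionPoints_eq_of_isAlgClosed ℂ (n : ℤ) hn', Int.natAbs_natCast,
    dim_fibre_of_isOfRelDim hA t, A.natCard_kerPoints_fibreHom_quotientMk u K hcov hG hsm hgc hfree t] at h1
  rw [h1, Nat.mul_comm]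

/-- **`#T_t · #K ≤ n^{2g}` — the `hcount` input of ★ `hStab_of_level_of_count`**, for `A/S` of relative dimension `g` over a
reduced locally Noetherian base, `n ≠ 0`, at a complex point `t`: the set
`T_t = {b ∈ Â_t(ℂ) | (1_{A/K} × b)^*𝒩₁ ≅ 𝒪}` (`𝒩₁ = (π × 1)^*𝒫`) is finite with `#T_t ≤ #ker π_t(ℂ)` ([MumfordAV1970] §15
Thm. 1, ★ `DualPair.finite_and_ncard_le_natCard_kerPoints`, `π_t` an isogeny by `isIsogeny_fibreHom_quotientMk_and_mulNDesc`)
and `#ker π_t(ℂ) · #K = n^{2g}` (`natCard_kerPoints_fibreHom_mulNDesc_mul_natCard`).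
[cite: MumfordAV1970, §15 Thm. 1 (p. 143)] [cite: MumfordAV1970, §7 Thm. 4 (p. 72)] -/
theorem finite_and_ncard_mul_natCard_le_pow [IsReduced S] [IsLocallyNoetherian S] {g : ℕ} (hA : A.IsOfRelDim g)
    (hn0 : n ≠ 0) (t : Spec (.of ℂ) ⟶ S) :
    {b : D.hat.FibrePoints t | Nonempty ((Scheme.Modules.pullback
        ((A.quotientBy u K hcov hG hsm hgc).baseChangeToProd D.hat t b.left (Over.w b))).obj
        (A.poincarePullbackBundle u K hK hcov hG hsm hgc D hfree).L ≅ SheafOfModules.unit _)}.Finite ∧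
      {b : D.hat.FibrePoints t | Nonempty ((Scheme.Modules.pullback
          ((A.quotientBy u K hcov hG hsm hgc).baseChangeToProd D.hat t b.left (Over.w b))).obj
          (A.poincarePullbackBundle u K hK hcov hG hsm hgc D hfree).L ≅ SheafOfModules.unit _)}.ncard * Nat.card K ≤
        n ^ (2 * g) := by
  letI : GrpObj (A.quotientOver u K) := (A.quotientBy u K hcov hG hsm hgc).grpObj
  haveI := A.isMonHom_mulNDesc u K hK hcov hG hsm hgc hfree
  have hn : (n : ℂ) ≠ 0 := by exact_mod_cast hn0
  obtain ⟨-, hπ⟩ := A.isIsogeny_fibreHom_quotientMk_and_mulNDesc u K hK hcov hG hsm hgc hfree hA t hn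
  obtain ⟨hfin, hle⟩ := DualPair.finite_and_ncard_le_natCard_kerPoints (X := A.quotientBy u K hcov hG hsm hgc) D
    (A.mulNDesc u K hK hcov) t hπ
  refine ⟨hfin, ?_⟩
  rw [← A.natCard_kerPoints_fibreHom_mulNDesc_mul_natCard u K hK hcov hG hsm hgc hfree hA hn0 t]
  exact Nat.mul_le_mul_right _ hle

end Complex

end AbelianSchemeOver

end Literature.AlgebraicGeometry.AbelianSchemes

end
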